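import Literature.AnabelianGeometry.EtaleTheta.Discharge.Sec5DeltaTransportOfConnectedTemperoidLevelN
import Literature.AnabelianGeometry.EtaleTheta.Discharge.Sec5PsiPreservesFrobeniusTrivial
import Literature.AnabelianGeometry.EtaleTheta.Discharge.Sec4ConnectedPartEquivalenceRes
import Literature.AnabelianGeometry.EtaleTheta.ThetaSubquotientLevelNTwist

/-!
# [EtTh] Thm. 5.6, T56-L03: the DATA of the Δ-transport `aΨ` EXIST for every self-equivalence `Ψ` at the genuine §5 data
# over `B^temp(Π^tp_X)⁰` — hence the K4 end knit's pair `(aΨ, haΨn)` exists for every `Ψ` (p.329 / PDF p.103)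

S. Mochizuki, *The étale theta function and its Frobenioid-theoretic manifestations*, Publ. RIMS **45** (2009)
[MochizukiEtTh2009], Thm. 5.6 proof p.328 (PDF p.102) l.−4 – p.329 l.1: «it follows [cf. Proposition 5.1; [FrdI], Theorem 3.4, (iv),
(v)] that `Ψ` … induces a 1-compatible equivalence `Ψ^bs : D ⥲ D`, hence [cf. [SemiAnbd], Proposition 3.2] an outer automorphism of the
tempered fundamental group … In particular, it follows from Propositions 2.4, 2.6 that `Ψ` preserves "`(l·Δ_Θ)_{(−)}`"»; Cor. 2.18 (i)
p.286 (PDF p.60).  S. Mochizuki, *The geometry of Frobenioids I* [MochizukiFrdI2008], Thm. 3.4 (v) p.63; *Semi-graphs of anabelioids*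
[MochizukiSemiAnbd2006], Prop. 3.2 p.35.

abc-iut cell, layer L2, seat abc-iut-w5-d013 (gen 5), self-named ROW «Δ-TRANSPORT DATA EXIST FOR EVERY Ψ AT THE GENUINE DATA» (STATUS
2026-08-26T13:00Z; = §5 of this seat's gen-4 memo HOME/staging/w5/w5-d013/g4/T56-L03-STEP2-MEMO.md).  PROOF-ONLY (no definition, no new
named fact); nothing landed is edited or restated.

abc-iut-w5-d020's `ThetaFrobenioid.deltaTransport` (`Discharge/Sec5DeltaTransportOfConnectedTemperoidLevelN.lean`, p443762) — the Δ-transport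
`aΨ A : 𝔉.lDeltaModN A ≃* 𝔉.lDeltaModN (Ψ A)` of the K4 END KNIT (abc-iut-w5-d034's p437581 / p442234 / p444342) at the genuine §5 data
`𝔉 := ofConnectedTemperoidData h (RD.levelStub ιX) …` — takes EIGHT DATA: the base `Ψbs` of `Ψ` with the knit's identification
`eΨ : Ψ ⋙ 𝔉.base ≅ 𝔉.base ⋙ Ψbs`, the [SemiAnbd] Prop. 3.2 datum `(φ, η : Ψbs ⋙ ι ≅ ι ⋙ B^temp(φ))` and its level-`N` descent
`(φQ, φΛ, hq, hι)`; its header defers their existence to this seat's gen-4 theorems.  This file PRODUCES them for EVERY self-equivalence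
`Ψ` of the tempered Frobenioid over `B^temp(Π^tp_X)⁰`, from theorems of the tree consumed BY NAME:
* `Ψbs` an equivalence with `eΨ` — [FrdI] Thm. 3.4 (v), abc-iut-L1-d4's `psiBase`, packaged at the setting by this seat's
  `BiKummerSetting.exists_psiBase_frobeniusType_degFr` (`Discharge/Sec5PsiPreservesFrobeniusTrivial.lean`, p445745) under the model
  hypotheses (`Φ` non-dilating, a non-group-like object; base of FSM-type and slim = THEOREMS for `B^temp(Π^tp_X)⁰`);
* `φ : Π^tp_X ≃ₜ* Π^tp_X` with `η` — [SemiAnbd] Prop. 3.2 for equivalences of CONNECTED temperoids, this seat's gen-4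
  `BTemp.exists_continuousMulEquiv_res_iso_of_connectedPart_equivalence` (p435495);
* `(φQ, φΛ, hq, hι)` + the `thetaMod`/`LevelQuot` clauses — this seat's gen-4 `RigidData.exists_levelTwistData_of_cor218` (p438441)
  at `γ := ιX⁻¹ ∘ φ ∘ ιX`, from the ONE named input `h218 : RD.Cor218_i` ([EtTh] Cor. 2.18 (i): `Π^tp_Ÿ`, `Ker(Π ↠ Π^Θ)`, `l·Δ_Θ`, …
  stable under every automorphism of the topological group `Π^tp_X` — print's «Propositions 2.4, 2.6»).
RESULTS: `exists_deltaTransportData_ofConnectedTemperoidData` (the eight data, with the two extra Cor. 2.18 (i) clauses needed downstream for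
`hT09c`), and the COROLLARY `exists_deltaTransport_natural`: **for every `Ψ` there is `aΨ : ∀ A, 𝔉.lDeltaModN A ≃* 𝔉.lDeltaModN (Ψ A)`
satisfying the K4 end knit's naturality binder `haΨn`** (abc-iut-w5-d020's `deltaTransport_natural`) — the pair `(aΨ, haΨn)` EXISTS with no
data binder left; the last γ-input `hT09c`/`hδc` is abc-iut-w5-d034's FILE B and is not touched here.
HONEST FRAMING: kernel-checked category theory; the anabelian content enters only through the named input `RD.Cor218_i`; [EtTh]/[FrdI]/
[SemiAnbd] are refereed pre-IUT material; nothing here bears on [IUTchIII] Cor. 3.12 — no side is taken; typed ≠ proved for the named input.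
-/

noncomputable section

namespace Literature.AnabelianGeometry.EtaleTheta

namespace ThetaFrobenioid

open CategoryTheory Opposite Literature.AlgebraicGeometry.Frobenioids Literature.AnabelianGeometry.SemiGraphs
  Literature.AnabelianGeometry.SemiGraphs.GaloisObjects

universe u₀ v₀ w'

variable {K : Type u₀} [Field K] {X : SemiGraphs.TemperedArithmeticGroup.{u₀} K} {D₀ : Type u₀} [Category.{v₀} D₀]
  {V : FrdIMonoidStub.{max u₀ w'}} {T₀ : RealifiedDivisorMonoids (D₀ := D₀) V}
  {VD : FrdICatStub.{u₀ + 1, u₀, max u₀ w'} (ConnectedPart (BTemp X.Pi))}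
  {tf : TemperedFrobenioid T₀ (ConnectedPart (BTemp X.Pi)) VD} {hZ : tf.monoidType = MonoidType.Z}
  {hP : ∀ A : (ConnectedPart (BTemp X.Pi))ᵒᵖ, IsPerfect (tf.Φ.carrier A)}
  {NH : Subgroup (Field.absoluteGaloisGroup K) → tf.category → ℕ+ → Prop} {A₀ : tf.category}
  {hA₀ : PreFrobenioid.IsFrobeniusTrivial tf.toElem A₀} {hA₀' : SemiGraphs.IsGaloisObj A₀.base.obj}
  {lv N : ℕ+} {l' : ℕ} {RD : RigidData.{max u₀ w'} N l'}
  {pullFrac : ∀ {A A' : (BiKummerSetting.mkOfConnectedTemperoid X tf hZ hP NH A₀ hA₀ hA₀').C} (_ : A' ⟶ A),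
    (BiKummerSetting.mkOfConnectedTemperoid X tf hZ hP NH A₀ hA₀ hA₀').biratUnits A →
      (BiKummerSetting.mkOfConnectedTemperoid X tf hZ hP NH A₀ hA₀ hA₀').biratUnits A'}
  {θ : (BiKummerSetting.mkOfConnectedTemperoid X tf hZ hP NH A₀ hA₀ hA₀').biratUnits
    (BiKummerSetting.mkOfConnectedTemperoid X tf hZ hP NH A₀ hA₀ hA₀').Aodot}
  {Bl : (BiKummerSetting.mkOfConnectedTemperoid X tf hZ hP NH A₀ hA₀ hA₀').C}
  {Pl : (BiKummerSetting.mkOfConnectedTemperoid X tf hZ hP NH A₀ hA₀ hA₀').FractionPair θ Bl}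
  {Rl : (BiKummerSetting.mkOfConnectedTemperoid X tf hZ hP NH A₀ hA₀ hA₀').NthRoot θ Pl lv pullFrac}
  (ιX : RD.PiX ≃ₜ* X.Pi) [RD.iotaN.range.Normal]
  (h : ModelFrobenioid.Hypotheses tf.divisorMonoid tf.ratFnFunctor) (odd_l : Odd (lv : ℕ))
  (R : (BiKummerSetting.mkOfConnectedTemperoid X tf hZ hP NH A₀ hA₀ hA₀').NthRoot Rl.root Rl.pair N pullFrac)
  (K' : Type (max u₀ w')) [Field K'] (constEmb : K'ˣ →* tf.biratUnitsModel R.BN)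
  (constEmb_injective : Function.Injective constEmb)
  (hinvc : ∀ g : Aut R.AN.base,
    pull tf.divisorMonoid g.hom (ModelFrobenioid.div R.pair.num) = ModelFrobenioid.div R.pair.num)
  (hinvp : ∀ y : RD.PiX, y ∈ RD.PiYdd →
    pull tf.divisorMonoid ((BiKummerSetting.mkOfConnectedTemperoid X tf hZ hP NH A₀ hA₀ hA₀').galoisSurj R.AN.base
      R.αData.isGalois (ιX y)).hom (ModelFrobenioid.div R.pair.den) = ModelFrobenioid.div R.pair.den)

/-! ### 1. The [SemiAnbd] Prop. 3.2 datum `(φ, η)` and its level-`N` descent for a self-equivalence of `B^temp(Π^tp_X)⁰` -/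

omit [RD.iotaN.range.Normal] in
/-- **For every self-equivalence `Θ` of the connected temperoid `B^temp(Π^tp_X)⁰`: an ISOMORPHISM `φ` of tempered groups with
`Θ ⋙ ι ≅ ι ⋙ B^temp(φ)` ([SemiAnbd] Prop. 3.2, this seat's p435495) together with its level-`N` descent `(φQ, φΛ, hq, hι)` and the two
Cor. 2.18 (i) transport clauses on `thetaMod` / `LevelQuot`** (this seat's p438441 at `γ := ιX⁻¹ ∘ φ ∘ ιX`), from `h218 : RD.Cor218_i`.
[cite: MochizukiSemiAnbd2006, Prop 3.2 p.35] [cite: MochizukiEtTh2009, Cor 2.18(i) p.60] -/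
theorem exists_resIso_levelTwistData_of_cor218 (h218 : RD.Cor218_i)
    (Θ : ConnectedPart (BTemp X.Pi) ≌ ConnectedPart (BTemp X.Pi)) :
    ∃ (φ : X.Pi ≃ₜ* X.Pi)
      (_ : Θ.functor ⋙ (connectedObjects (BTemp X.Pi)).ι ≅ (connectedObjects (BTemp X.Pi)).ι ⋙ BTemp.res (φ : X.Pi →ₜ* X.Pi))
      (φQ : RD.LevelQuot ≃* RD.LevelQuot) (φΛ : RD.mu ≃* RD.mu),
      (∀ g : X.Pi, RD.qN ιX (φ g) = φQ (RD.qN ιX g)) ∧ (∀ a : RD.mu, RD.iotaN (φΛ a) = φQ (RD.iotaN a)) ∧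
      (∀ (g : RD.lDeltaTheta) (hg : ((ιX.trans φ).trans ιX.symm) (g : RD.PiX) ∈ RD.lDeltaTheta),
        φΛ (RD.thetaMod g) = RD.thetaMod ⟨((ιX.trans φ).trans ιX.symm) g, hg⟩) ∧
      (∀ k : RD.PiX, φQ ((k : RD.PiX) : RD.LevelQuot) = ((((ιX.trans φ).trans ιX.symm) k : RD.PiX) : RD.LevelQuot)) := by
  haveI := X.secondCountableTopology
  -- [SemiAnbd] Prop. 3.2 for the self-equivalence of the connected temperoid
  obtain ⟨φ, φ', hφ, ⟨η⟩⟩ := BTemp.exists_continuousMulEquiv_res_iso_of_connectedPart_equivalence X.isTempered X.isTempered Θ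
  have hφ' : (φ : X.Pi →ₜ* X.Pi) = φ' := ContinuousMonoidHom.ext hφ
  -- [EtTh] Cor. 2.18 (i): the level-`N` descent of `γ := ιX⁻¹ ∘ φ ∘ ιX`
  obtain ⟨φQ, φΛ, hq, hι, hΛ, hQ⟩ := RD.exists_levelTwistData_of_cor218 h218 ιX ((ιX.trans φ).trans ιX.symm)
  refine ⟨φ, hφ' ▸ η, φQ, φΛ, fun g => ?_, hι, hΛ, hQ⟩
  have e : ((ιX.symm.trans ((ιX.trans φ).trans ιX.symm)).trans ιX) g = φ g := by
    change ιX (ιX.symm (φ (ιX (ιX.symm g)))) = φ g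
    rw [ιX.apply_symm_apply, ιX.apply_symm_apply]
  rw [← e]
  exact hq g

/-! ### 2. The eight data of `deltaTransport` exist for every self-equivalence `Ψ` -/

omit [RD.iotaN.range.Normal] in
include h in
/-- **The DATA of the Δ-transport EXIST for every self-equivalence `Ψ`** of the tempered Frobenioid over `B^temp(Π^tp_X)⁰` at the
genuine §5 data `𝔉 := ofConnectedTemperoidData h (RD.levelStub ιX) …` — the eight binders `(Ψbs, eΨ, φ, η, φQ, φΛ, hq, hι)` of
abc-iut-w5-d020's `deltaTransport` (p443762), `Ψbs` an EQUIVALENCE, plus the two Cor. 2.18 (i) clauses on `thetaMod` / `LevelQuot` for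
`γ := ιX⁻¹ ∘ φ ∘ ιX` (the currency of the knit's `hγ`): [FrdI] Thm. 3.4 (v) (abc-iut-L1-d4's `psiBase`, via this seat's
`BiKummerSetting.exists_psiBase_frobeniusType_degFr`; base of FSM-type / slim are theorems for `B^temp(Π^tp_X)⁰`) + §1.  Inputs: the model
hypotheses `hnd` (`Φ` non-dilating), `hN` (a non-group-like object) and `h218 : RD.Cor218_i`.
[cite: MochizukiEtTh2009, Thm 5.6 proof p.329 (PDF p.103)] -/
theorem exists_deltaTransportData_ofConnectedTemperoidData (hnd : IsNonDilatingOn tf.divisorMonoid)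
    (hN : ∃ A : (BiKummerSetting.mkOfConnectedTemperoid X tf hZ hP NH A₀ hA₀ hA₀').C,
      ¬ (PreFrobenioidData.ofModel tf.divisorMonoid tf.ratFnFunctor tf.divBNatTrans).IsGroupLikeObj A)
    (h218 : RD.Cor218_i)
    (Ψ : (BiKummerSetting.mkOfConnectedTemperoid X tf hZ hP NH A₀ hA₀ hA₀').C ≌ (BiKummerSetting.mkOfConnectedTemperoid X tf hZ hP NH A₀ hA₀ hA₀').C) :
    ∃ (Ψbs : ConnectedPart (BTemp X.Pi) ⥤ ConnectedPart (BTemp X.Pi)) (_ : Ψbs.IsEquivalence)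
      (_ : Ψ.functor ⋙ (ofConnectedTemperoidData h (RD.levelStub ιX) odd_l R ιX K' constEmb constEmb_injective hinvc hinvp).base ≅
        (ofConnectedTemperoidData h (RD.levelStub ιX) odd_l R ιX K' constEmb constEmb_injective hinvc hinvp).base ⋙ Ψbs)
      (φ : X.Pi ≃ₜ* X.Pi)
      (_ : Ψbs ⋙ (connectedObjects (BTemp X.Pi)).ι ≅ (connectedObjects (BTemp X.Pi)).ι ⋙ BTemp.res (φ : X.Pi →ₜ* X.Pi))
      (φQ : RD.LevelQuot ≃* RD.LevelQuot) (φΛ : RD.mu ≃* RD.mu),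
      (∀ g : X.Pi, RD.qN ιX (φ g) = φQ (RD.qN ιX g)) ∧ (∀ a : RD.mu, RD.iotaN (φΛ a) = φQ (RD.iotaN a)) ∧
      (∀ (g : RD.lDeltaTheta) (hg : ((ιX.trans φ).trans ιX.symm) (g : RD.PiX) ∈ RD.lDeltaTheta),
        φΛ (RD.thetaMod g) = RD.thetaMod ⟨((ιX.trans φ).trans ιX.symm) g, hg⟩) ∧
      (∀ k : RD.PiX, φQ ((k : RD.PiX) : RD.LevelQuot) = ((((ιX.trans φ).trans ιX.symm) k : RD.PiX) : RD.LevelQuot)) := by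
  -- [FrdI] Thm. 3.4 (v): the 1-compatible equivalence `Ψ^bs`
  obtain ⟨Ψbs, hΨbs, eΨ, -, -, -⟩ :=
    (BiKummerSetting.mkOfConnectedTemperoid X tf hZ hP NH A₀ hA₀ hA₀').exists_psiBase_frobeniusType_degFr h
      QuasiTemperoid.BTempConnected.connectedPart_isOfFSMType (TemperedArithmeticGroup.isSlim_connectedPart X) hnd hN Ψ
  -- [SemiAnbd] Prop. 3.2 + Cor. 2.18 (i) for `Ψ^bs`
  obtain ⟨φ, η, φQ, φΛ, hq, hι, hΛ, hQ⟩ := exists_resIso_levelTwistData_of_cor218 ιX h218 Ψbs.asEquivalence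
  exact ⟨Ψbs, hΨbs, eΨ, φ, η, φQ, φΛ, hq, hι, hΛ, hQ⟩

/-! ### 3. Corollary: the K4 end knit's pair `(aΨ, haΨn)` exists for every `Ψ` -/

include h in
/-- **For every self-equivalence `Ψ`, the Δ-transport `aΨ` with its naturality `haΨn` EXISTS** at the genuine §5 data
`𝔉 := ofConnectedTemperoidData h (RD.levelStub ιX) …`: `∃ aΨ : ∀ A, 𝔉.lDeltaModN A ≃* 𝔉.lDeltaModN (Ψ A)` with, for every `f : A → A′`,
`aΨ A′ (((l·Δ_Θ) ⊗ ℤ/Nℤ)(f) x) = ((l·Δ_Θ) ⊗ ℤ/Nℤ)(Ψ f) (aΨ A x)` — the binders `(aΨ, haΨn)` of abc-iut-w5-d034's K4 END KNIT (p437581 / p442234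
/ p444342) with NO data binder left: `aΨ := deltaTransport …` (abc-iut-w5-d020, p443762) at the data of §2, `haΨn := deltaTransport_natural`.
Inputs: `hnd`, `hN`, `h218 : RD.Cor218_i` only.  [cite: MochizukiEtTh2009, Thm 5.6 proof p.329 (PDF p.103)] -/
theorem exists_deltaTransport_natural (hnd : IsNonDilatingOn tf.divisorMonoid)
    (hN : ∃ A : (BiKummerSetting.mkOfConnectedTemperoid X tf hZ hP NH A₀ hA₀ hA₀').C,
      ¬ (PreFrobenioidData.ofModel tf.divisorMonoid tf.ratFnFunctor tf.divBNatTrans).IsGroupLikeObj A)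
    (h218 : RD.Cor218_i)
    (Ψ : (BiKummerSetting.mkOfConnectedTemperoid X tf hZ hP NH A₀ hA₀ hA₀').C ≌ (BiKummerSetting.mkOfConnectedTemperoid X tf hZ hP NH A₀ hA₀ hA₀').C) :
    ∃ aΨ : ∀ A : (BiKummerSetting.mkOfConnectedTemperoid X tf hZ hP NH A₀ hA₀ hA₀').C,
        (ofConnectedTemperoidData h (RD.levelStub ιX) odd_l R ιX K' constEmb constEmb_injective hinvc hinvp).lDeltaModN A ≃*
          (ofConnectedTemperoidData h (RD.levelStub ιX) odd_l R ιX K' constEmb constEmb_injective hinvc hinvp).lDeltaModN (Ψ.functor.obj A),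
      ∀ ⦃A A' : (BiKummerSetting.mkOfConnectedTemperoid X tf hZ hP NH A₀ hA₀ hA₀').C⦄ (f : A ⟶ A')
        (x : (ofConnectedTemperoidData h (RD.levelStub ιX) odd_l R ιX K' constEmb constEmb_injective hinvc hinvp).lDeltaModN A),
        aΨ A' ((ofConnectedTemperoidData h (RD.levelStub ιX) odd_l R ιX K' constEmb constEmb_injective hinvc hinvp).lDeltaModNMap f x) =
          (ofConnectedTemperoidData h (RD.levelStub ιX) odd_l R ιX K' constEmb constEmb_injective hinvc hinvp).lDeltaModNMap (Ψ.functor.map f)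
            (aΨ A x) := by
  obtain ⟨Ψbs, hΨbs, eΨ, φ, η, φQ, φΛ, hq, hι, -, -⟩ :=
    exists_deltaTransportData_ofConnectedTemperoidData.{u₀, v₀, w'} ιX h odd_l R K' constEmb constEmb_injective hinvc hinvp hnd hN h218 Ψ
  exact ⟨deltaTransport.{u₀, v₀, w'} ιX h odd_l R K' constEmb constEmb_injective hinvc hinvp Ψ Ψbs eΨ φ η φQ φΛ hq hι,
    fun A A' f x => deltaTransport_natural.{u₀, v₀, w'} ιX h odd_l R K' constEmb constEmb_injective hinvc hinvp Ψ Ψbs eΨ φ η φQ φΛ hq hι f x⟩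

end ThetaFrobenioid

end Literature.AnabelianGeometry.EtaleTheta

end
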